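/-
Copyright (c) 2026 the pub-hodgecm-mathlib formalisation cell (harness21).  Prover seat hodgecm-mathlib-F0P3a-p02 (g27), 2026-09-03.  Road M6 «ROW 2 ★ DYADIC TWIN» → F3
«TOT-Λ BY OVER-ORDERS» (LEAD F0P3a-plan T14-66 ∕ T15-08; WORD #77 queue), carve (c10b-S) «GATE AT b = 0, SUFFICIENCY» (F3-5 pen LH7-p04 (g12) 00:24:06Z ∕ 00:34:25Z:
(S1)(S2) = LH10-p01 (g11), (S3) = this seat), part (S3-W) «THE WITNESS FROM A K-PLANE GRAM».
-/
import Literature.NumberTheory.Automorphic.SelfDualProductOrderGate   -- ★ p853089 (this seat) (c10b-N): `pairing_adjoint`, `smul_mulVec_idem_eq`, `pairing_mul_smul_idem_fst`; brings ★ F3-2a `SelfDualCyclicOverOrderTorsor` (`mem_span_image_mulVec_iff`), ★ F3-2b FILE 1, ★ [T2-a], ★ `FixedCosetsStableLattices` (L1 docking `exists_mem_unitary_span_eq_iff_selfDual`), ★ `HeckeTransversalGL` (`mem_glInt_of_isIntegralMatrix`)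
import HarnessLib

/-!
# The gate at glue depth `b = 0`, sufficiency, part W: a self-dual lattice cyclic for the PRODUCT over-order from an `E`-line unit and a unimodular `K`-plane Gram

Topic `NumberTheory/Automorphic`; namespace `Literature.NumberTheory.Automorphic`.  THEOREMS ONLY (no definition, no instance, no notation, no named fact, no `sorry`);
kernel lane `--supports stmt-HodgeConjecture-24833`.  Cell `pub/hodgecm-mathlib` (D-0151), crux H413 = `stmt-HodgeConjecture-24833`; road M6 → F3 «TOT-Λ by over-orders»
(route (B)), carve (c10b) «gate at `b = 0`» for the F3-5b assembly (LH7-p04 (g12)): ★ (c10b-N) `SelfDualProductOrderGate` gives the `hbad` half at the PRODUCT strata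
`G(N″, 0, c′)`; the `hgood` half (★ F3-2a `ncard_setOf_selfDual_cyclicOver_eq_relIndex`'s witness `hb₀` at every product stratum in class I) is split (SIG-c10b-S v1,
F0P3a-p02 (g27) 00:33Z) into (S1) «K-LINE GRAM» + (S2) «NORM SUPPLY» (LH10-p01 (g11), `K`-internal) and **(S3) = THIS FILE, the lattice side**: in ★ F3-2a ∕ F3-2b's
endoscopic-carrier currency VERBATIM (`B = E × K`, `φ`, `τ_B`, `w₀`, `hstar`, `J ∈ GL₃(𝒪)` hermitian, `σ` with trace-one element and unit norms — the L1-docking binders of ★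
`exists_mem_unitary_span_eq_iff_selfDual`) and ★ (c4)'s integral dictionary (`incl = (coe, coe) : 𝒪_E × 𝒪_K → E × K`, `jO : 𝒪_E →+* 𝒪_K` over `algebraMap`), for ANY subring
`S ≤ 𝒪_E × 𝒪_K` whose underlying set is `{z | ∃ p q, z.2 = jO p + jO q·Π}` (the product order `𝒪_E × (𝒪_E ⊕ 𝒪_E Π)`; ★ (c10) §0 at `Π = Π_{N″} = jO(ϖ^{N″})·θ`): **given `c₀ ∈ E`
with `|σ(c₀)c₀⟨x₀′, x₀′⟩| = 1` (`x₀′ = φ(1,0)w₀`; the `E`-line, class I) and `b₂ ∈ K` whose `K`-plane Gram `(P((0,b₂Πⁱ),(0,b₂Πʲ)))_{i,j ≤ 1}` is INTEGRAL with UNIT determinant,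
the lattice `Λ_{incl S}(φ(c₀, b₂)·w₀)` is self-dual**: `∃ b₀ : (E × K)ˣ, ∃ u ∈ U(σ, J), Λ_{incl S}(φ(b₀)w₀) = Λ(u)` — ★ F3-2a's `hb₀` TOKEN FOR TOKEN.  (S1) supplies the three
`K`-plane values `0, 1, ϖ^{N″}a` for `b₂` with `b₂·σ_K b₂ = ν`, (S2) supplies such a `b₂` in class I; the (c10b-S) head in the pen's letters (`Even (log|⟨x₀,x₀⟩_J|) → …`)
is the short assembly on top (separate file, after (S1)(S2) ★).  No `2`, no `d`, no parity binder, no discreteness; `n = 3`.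
HONEST LABEL: HC_CM is proved only modulo the 7 printed citations (2 remaining named inputs: hLiu418 = stmt-HodgeConjecture-24832, h413 = stmt-HodgeConjecture-24833) until
rung 0 closes; elementary lattice algebra over a valuation ring, asserts nothing printed; count-neutral (zero label movement until F5 ★ and a desk-priced rider).

THE MATHEMATICS.  `P(m, m′) := σ(φ(m)w₀)ᵀ J φ(m′)w₀` has adjoint `b ↦ b⋆ = (σ b₁, σ_K b₂)` (★ `pairing_adjoint`), hence is ORTHOGONAL for `E × 0 ⊥ 0 × K` (`e₁⋆(0, y) = 0`).  For
`b = (c₀, b₂)` the three vectors `v₀ = φ(c₀, 0)w₀ = c₀·x₀′`, `v₁ = φ(0, b₂)w₀`, `v₂ = φ(0, Πb₂)w₀` have Gram matrix `σ(M)ᵀ J M = diag(σ(c₀)c₀⟨x₀′,x₀′⟩, T)` with `T` the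
`K`-plane Gram — integral with unit determinant by hypothesis — so `M = [v₀|v₁|v₂] ∈ GL₃(E)` and `σ(M)ᵀJM ∈ GL₃(𝒪)`, whence `Λ(M) = Λ(u)` for a `u ∈ U(σ, J)` (★ L1 docking,
Jacobowitz: a lattice with unimodular Gram matrix is `u·𝒪³`); and `Λ(M) = Λ_{incl S}(φ(b)w₀)` because `incl S = 𝒪·e₁ ⊕ 𝒪·e₂ ⊕ 𝒪·(0, Π)` and `x ↦ φ(x)·φ(b)w₀` is `𝒪`-linear
with `eᵢ ↦ vᵢ`.  [cite: Jacobowitz1962, §4, §7 Thm. 7.1] [cite: Serre1980Trees, Ch. II §1.1] [cite: Rogawski1990, §4.9 Lemma 4.9.3 p. 56, Prop. 4.9.1 (b) p. 55]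

* §1 `transpose_map_mul_mul_apply_eq_dotProduct` (entries of `σ(M)ᵀJM` are pairings of columns), `pairing_fst_zero_snd_eq_zero`, `pairing_zero_snd_fst_eq_zero` (orthogonality),
  `pairing_zero_snd_zero_snd_eq` (`P((0,y),(0,y′)) = P((0,1),(0,σ_K(y)y′))`, the (S1) dictionary).
* §2 **`exists_selfDual_cyclicOver_map_of_kPlane_gram`** (the witness).

## References
* [Jacobowitz1962] R. Jacobowitz, *Hermitian forms over local fields*, Amer. J. Math. 84 (1962): §4 (Gram matrices, dual lattices), §7 Thm. 7.1 (unimodular lattices).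
* [Serre1980Trees] J.-P. Serre, *Trees* (1980): Ch. II §1.1 (lattices over valuation rings).
* [Rogawski1990] J. D. Rogawski, *Automorphic Representations of Unitary Groups in Three Variables*, Ann. of Math. Stud. 123 (1990): §4.9 Lemma 4.9.3 p. 56, Prop. 4.9.1 (b) p. 55.
* [HornJohnson2013] R. A. Horn, C. R. Johnson, *Matrix Analysis* (2nd ed. 2013): §0.8.5 (block-triangular determinants), §3.2.4 (cyclic vectors).
-/

set_option autoImplicit false

noncomputable section

open Matrix
open scoped MatrixGroups ValuativeRel

namespace Literature.NumberTheory.Automorphic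

open Literature.NumberTheory.Automorphic.UnitaryGroup

section Witness

variable {E : Type*} [Field E] [ValuativeRel E] (σ : E →+* E) {K : Type*} [Field K] [ValuativeRel K] [Algebra E K] (σK : K →+* K)
  (hσσ : ∀ x, σ (σ x) = x) (hσO : ∀ x : 𝒪[E], σ x ∈ 𝒪[E])
  (htr : ∃ b : 𝒪[E], (b : E) + σ b = 1) (hnorm : ∀ u : 𝒪[E], IsUnit u → σ u = u → ∃ t : 𝒪[E], (t : E) * σ t = u)
  (J : GL (Fin 3) E) (hJ : J ∈ glInt 3 E) (hJh : ((J : Matrix (Fin 3) (Fin 3) E).map σ)ᵀ = J)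
  (τ : Matrix (Fin 3) (Fin 3) E) {w₀ : Fin 3 → E} (hK : IsUnit (Matrix.of fun i j : Fin 3 => ((τ ^ (j : ℕ)) *ᵥ w₀) i).det)
  (φ : (E × K) →ₐ[E] Matrix (Fin 3) (Fin 3) E) (hφ : Function.Injective φ) (τB : E × K) (hτB : φ τB = τ)
  (hstar : ∀ b : E × K, (J : Matrix (Fin 3) (Fin 3) E) * φ (RingHom.prodMap σ σK b) = ((φ b).map σ)ᵀ * J)

/-! ## §1 Gram entries are pairings; orthogonality `E × 0 ⊥ 0 × K`; the `K`-plane dictionary -/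

omit [ValuativeRel E] in
/-- The entries of `σ(M)ᵀ·J·M` are the pairings `σ(M e_k)ᵀ J (M e_l)` of the columns of `M`. [cite: Jacobowitz1962, §4] -/
theorem transpose_map_mul_mul_apply_eq_dotProduct (M : Matrix (Fin 3) (Fin 3) E) (k l : Fin 3) :
    ((M.map σ)ᵀ * (J : Matrix (Fin 3) (Fin 3) E) * M) k l = dotProduct (fun i => σ (M i k)) ((J : Matrix (Fin 3) (Fin 3) E) *ᵥ fun i => M i l) := by
  simp only [Matrix.mul_apply, Matrix.transpose_apply, Matrix.map_apply, dotProduct, Matrix.mulVec, Finset.sum_mul, Finset.mul_sum]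
  rw [Finset.sum_comm]
  exact Finset.sum_congr rfl fun i _ => Finset.sum_congr rfl fun j _ => by ring

omit [ValuativeRel E] [ValuativeRel K] in
include hstar in
/-- ORTHOGONALITY `P((c, 0), (0, y)) = 0` (`(c,0) = e₁(c,0)`, `e₁⋆(0,y) = 0`). [cite: Jacobowitz1962, §4] -/
theorem pairing_fst_zero_snd_eq_zero (c : E) (y : K) :
    dotProduct (fun i => σ ((φ ((c, 0) : E × K) *ᵥ w₀) i)) ((J : Matrix (Fin 3) (Fin 3) E) *ᵥ (φ ((0, y) : E × K) *ᵥ w₀)) = 0 := by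
  have h1 : ((c, 0) : E × K) = ((1, 0) : E × K) * ((c, 0) : E × K) := by ext <;> simp
  have h2 : RingHom.prodMap σ σK ((1, 0) : E × K) * ((0, y) : E × K) = 0 := by ext <;> simp
  rw [h1, pairing_adjoint σ σK J φ (w₀ := w₀) hstar, h2, map_zero, Matrix.zero_mulVec, Matrix.mulVec_zero, dotProduct_zero]

omit [ValuativeRel E] [ValuativeRel K] in
include hstar in
/-- ORTHOGONALITY `P((0, y), (c, 0)) = 0` (`(0,y) = e₂(0,y)`, `e₂⋆(c,0) = 0`). [cite: Jacobowitz1962, §4] -/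
theorem pairing_zero_snd_fst_eq_zero (c : E) (y : K) :
    dotProduct (fun i => σ ((φ ((0, y) : E × K) *ᵥ w₀) i)) ((J : Matrix (Fin 3) (Fin 3) E) *ᵥ (φ ((c, 0) : E × K) *ᵥ w₀)) = 0 := by
  have h1 : ((0, y) : E × K) = ((0, 1) : E × K) * ((0, y) : E × K) := by ext <;> simp
  have h2 : RingHom.prodMap σ σK ((0, 1) : E × K) * ((c, 0) : E × K) = 0 := by ext <;> simp
  rw [h1, pairing_adjoint σ σK J φ (w₀ := w₀) hstar, h2, map_zero, Matrix.zero_mulVec, Matrix.mulVec_zero, dotProduct_zero]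

omit [ValuativeRel E] [ValuativeRel K] in
include hstar in
/-- THE `K`-PLANE DICTIONARY `P((0, y), (0, y′)) = P((0, 1), (0, σ_K(y)·y′))` (`(0,y) = (1,y)·e₂`, adjoint) — the form read by (S1) «K-LINE GRAM» as `ℓ(σ_K(y)·y′)`,
`ℓ z := P(e₂, (0, z))`. [cite: Jacobowitz1962, §4] -/
theorem pairing_zero_snd_zero_snd_eq (y y' : K) :
    dotProduct (fun i => σ ((φ ((0, y) : E × K) *ᵥ w₀) i)) ((J : Matrix (Fin 3) (Fin 3) E) *ᵥ (φ ((0, y') : E × K) *ᵥ w₀)) =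
      dotProduct (fun i => σ ((φ ((0, 1) : E × K) *ᵥ w₀) i)) ((J : Matrix (Fin 3) (Fin 3) E) *ᵥ (φ ((0, σK y * y') : E × K) *ᵥ w₀)) := by
  have h1 : ((0, y) : E × K) = ((1, y) : E × K) * ((0, 1) : E × K) := by ext <;> simp
  have h2 : RingHom.prodMap σ σK ((1, y) : E × K) * ((0, y') : E × K) = ((0, σK y * y') : E × K) := by ext <;> simp
  rw [h1, pairing_adjoint σ σK J φ (w₀ := w₀) hstar, h2]

/-! ## §2 The witness -/

include hσσ hσO htr hnorm hJ hJh hstar in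
/-- **THE GATE AT `b = 0`, SUFFICIENCY (part W): A SELF-DUAL LATTICE CYCLIC FOR THE PRODUCT OVER-ORDER FROM AN `E`-LINE UNIT AND A UNIMODULAR `K`-PLANE GRAM.**
`S ≤ 𝒪_E × 𝒪_K` any subring with `↑S = {z | ∃ p q, z.2 = jO p + jO q·Π}` (the product order `𝒪_E × (𝒪_E ⊕ 𝒪_E Π)`; ★ (c10) §0's set at `Π = jO(ϖ^{N″})θ`), read in `E × K` along
`incl = (coe, coe)`; `c₀ ∈ E` with `|σ(c₀)·c₀·⟨x₀′, x₀′⟩| = 1` (`x₀′ = φ(1,0)w₀`), `b₂ ∈ K` with INTEGRAL `K`-plane Gram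
`T = (P((0, b₂Πⁱ), (0, b₂Πʲ)))_{i,j∈{0,1}}` of UNIT determinant.  Then `∃ b₀ : (E × K)ˣ, ∃ u ∈ U(σ, J), Λ_{incl S}(φ(b₀)w₀) = Λ(u)` — ★ F3-2a
`ncard_setOf_selfDual_cyclicOver_eq_relIndex`'s witness `hb₀` at `O := incl S`, with `b₀ = (c₀, b₂)`: the basis `M = [c₀x₀′ | φ(0,b₂)w₀ | φ(0,Πb₂)w₀]` of `Λ_{incl S}(φ(b₀)w₀)`
has Gram `σ(M)ᵀJM = diag(σ(c₀)c₀⟨x₀′,x₀′⟩, T) ∈ GL₃(𝒪)` (orthogonality §1), so ★ L1 docking `exists_mem_unitary_span_eq_iff_selfDual` applies.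
[cite: Jacobowitz1962, §4, §7 Thm. 7.1] [cite: Serre1980Trees, Ch. II §1.1] [cite: Rogawski1990, §4.9 Lemma 4.9.3 p. 56, Prop. 4.9.1 (b) p. 55] [cite: HornJohnson2013, §0.8.5] -/
theorem exists_selfDual_cyclicOver_map_of_kPlane_gram
    (jO : 𝒪[E] →+* 𝒪[K]) (hjO : ∀ y : 𝒪[E], ((jO y : 𝒪[K]) : K) = algebraMap E K (y : E))
    (S : Subring (𝒪[E] × 𝒪[K])) (PiN : 𝒪[K]) (hS : (S : Set (𝒪[E] × 𝒪[K])) = {z : 𝒪[E] × 𝒪[K] | ∃ p q : 𝒪[E], z.2 = jO p + jO q * PiN})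
    (c₀ : E) (hc₀ : ValuativeRel.valuation E (σ c₀ * c₀ *
      dotProduct (fun i => σ ((φ ((1, 0) : E × K) *ᵥ w₀) i)) ((J : Matrix (Fin 3) (Fin 3) E) *ᵥ (φ ((1, 0) : E × K) *ᵥ w₀))) = 1)
    (b₂ : K)
    (h00 : dotProduct (fun i => σ ((φ ((0, b₂) : E × K) *ᵥ w₀) i)) ((J : Matrix (Fin 3) (Fin 3) E) *ᵥ (φ ((0, b₂) : E × K) *ᵥ w₀)) ∈ 𝒪[E])
    (h01 : dotProduct (fun i => σ ((φ ((0, b₂) : E × K) *ᵥ w₀) i)) ((J : Matrix (Fin 3) (Fin 3) E) *ᵥ (φ ((0, (PiN : K) * b₂) : E × K) *ᵥ w₀)) ∈ 𝒪[E])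
    (h10 : dotProduct (fun i => σ ((φ ((0, (PiN : K) * b₂) : E × K) *ᵥ w₀) i)) ((J : Matrix (Fin 3) (Fin 3) E) *ᵥ (φ ((0, b₂) : E × K) *ᵥ w₀)) ∈ 𝒪[E])
    (h11 : dotProduct (fun i => σ ((φ ((0, (PiN : K) * b₂) : E × K) *ᵥ w₀) i)) ((J : Matrix (Fin 3) (Fin 3) E) *ᵥ (φ ((0, (PiN : K) * b₂) : E × K) *ᵥ w₀)) ∈ 𝒪[E])
    (hdet : ValuativeRel.valuation E
      (dotProduct (fun i => σ ((φ ((0, b₂) : E × K) *ᵥ w₀) i)) ((J : Matrix (Fin 3) (Fin 3) E) *ᵥ (φ ((0, b₂) : E × K) *ᵥ w₀)) *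
        dotProduct (fun i => σ ((φ ((0, (PiN : K) * b₂) : E × K) *ᵥ w₀) i)) ((J : Matrix (Fin 3) (Fin 3) E) *ᵥ (φ ((0, (PiN : K) * b₂) : E × K) *ᵥ w₀)) -
      dotProduct (fun i => σ ((φ ((0, b₂) : E × K) *ᵥ w₀) i)) ((J : Matrix (Fin 3) (Fin 3) E) *ᵥ (φ ((0, (PiN : K) * b₂) : E × K) *ᵥ w₀)) *
        dotProduct (fun i => σ ((φ ((0, (PiN : K) * b₂) : E × K) *ᵥ w₀) i)) ((J : Matrix (Fin 3) (Fin 3) E) *ᵥ (φ ((0, b₂) : E × K) *ᵥ w₀))) = 1) :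
    ∃ b₀ : (E × K)ˣ, ∃ u ∈ unitaryGroupOfForm σ (J : Matrix (Fin 3) (Fin 3) E),
      Submodule.span 𝒪[E] ((fun x : E × K => φ x *ᵥ (φ (b₀ : E × K) *ᵥ w₀)) ''
          (S.map (RingHom.prodMap (𝒪[E]).subtype (𝒪[K]).subtype) : Set (E × K))) =
        Submodule.span 𝒪[E] (Set.range ((u : Matrix (Fin 3) (Fin 3) E))ᵀ) := by
  classical
  set O : Subring (E × K) := S.map (RingHom.prodMap (𝒪[E]).subtype (𝒪[K]).subtype) with hOdef
  set e₁ : E × K := (1, 0) with he₁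
  set x₀ : Fin 3 → E := φ e₁ *ᵥ w₀ with hx₀
  -- the pairings
  set d₀ : E := dotProduct (fun i => σ (x₀ i)) ((J : Matrix (Fin 3) (Fin 3) E) *ᵥ x₀) with hd₀
  set T00 : E := dotProduct (fun i => σ ((φ ((0, b₂) : E × K) *ᵥ w₀) i)) ((J : Matrix (Fin 3) (Fin 3) E) *ᵥ (φ ((0, b₂) : E × K) *ᵥ w₀)) with hT00
  set T01 : E := dotProduct (fun i => σ ((φ ((0, b₂) : E × K) *ᵥ w₀) i)) ((J : Matrix (Fin 3) (Fin 3) E) *ᵥ (φ ((0, (PiN : K) * b₂) : E × K) *ᵥ w₀)) with hT01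
  set T10 : E := dotProduct (fun i => σ ((φ ((0, (PiN : K) * b₂) : E × K) *ᵥ w₀) i)) ((J : Matrix (Fin 3) (Fin 3) E) *ᵥ (φ ((0, b₂) : E × K) *ᵥ w₀)) with hT10
  set T11 : E := dotProduct (fun i => σ ((φ ((0, (PiN : K) * b₂) : E × K) *ᵥ w₀) i)) ((J : Matrix (Fin 3) (Fin 3) E) *ᵥ (φ ((0, (PiN : K) * b₂) : E × K) *ᵥ w₀)) with hT11
  -- non-degeneracy of the data
  have hd1 : ValuativeRel.valuation E (σ c₀ * c₀ * d₀) = 1 := hc₀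
  have hc00 : c₀ ≠ 0 := fun h0 => by rw [h0, mul_zero, zero_mul, map_zero] at hd1; exact zero_ne_one hd1
  have hb20 : b₂ ≠ 0 := fun h0 => by
    have hz : T00 = 0 := by
      rw [hT00, h0]
      have : ((0, (0 : K)) : E × K) = 0 := rfl
      rw [this, map_zero, Matrix.zero_mulVec, Matrix.mulVec_zero, dotProduct_zero]
    have hz' : T01 = 0 := by
      rw [hT01, h0]
      have : ((0, (0 : K)) : E × K) = 0 := rfl
      rw [this, map_zero, Matrix.zero_mulVec]
      simp
    have h := hdet
    rw [hz, hz', zero_mul, zero_mul, sub_zero, map_zero] at h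
    exact zero_ne_one h
  -- the unit `b₀ = (c₀, b₂)`
  set bb : E × K := (c₀, b₂) with hbb
  have hbbinv : bb * ((c₀⁻¹, b₂⁻¹) : E × K) = 1 := by
    ext <;> simp [hbb, hc00, hb20]
  set b₀ : (E × K)ˣ := Units.mkOfMulEqOne bb _ hbbinv with hb₀
  have hb₀val : (b₀ : E × K) = bb := rfl
  -- the three basis vectors, as products `mⱼ · b₀`
  set m : Fin 3 → E × K := ![((1, 0) : E × K), ((0, 1) : E × K), ((0, (PiN : K)) : E × K)] with hm
  have hm0 : m 0 * bb = ((c₀, 0) : E × K) := by ext <;> simp [hm, hbb]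
  have hm1 : m 1 * bb = ((0, b₂) : E × K) := by ext <;> simp [hm, hbb]
  have hm2 : m 2 * bb = ((0, (PiN : K) * b₂) : E × K) := by ext <;> simp [hm, hbb]
  set col : Fin 3 → (Fin 3 → E) := ![φ ((c₀, 0) : E × K) *ᵥ w₀, φ ((0, b₂) : E × K) *ᵥ w₀, φ ((0, (PiN : K) * b₂) : E × K) *ᵥ w₀] with hcol
  have hcolm : ∀ j : Fin 3, col j = φ (m j * bb) *ᵥ w₀ := by
    intro j; fin_cases j
    · simp [hcol, hm0]
    · simp [hcol, hm1]
    · simp [hcol, hm2]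
  -- `col 0 = c₀ • x₀`
  have hcol0 : φ ((c₀, 0) : E × K) *ᵥ w₀ = c₀ • x₀ := by
    have : ((c₀, 0) : E × K) = c₀ • e₁ := by ext <;> simp [he₁]
    rw [this, hx₀, smul_mulVec_idem_eq φ]
  -- the matrix `M` with columns `col j`, its Gram
  set M : Matrix (Fin 3) (Fin 3) E := Matrix.of fun i j => col j i with hM
  set G : Matrix (Fin 3) (Fin 3) E := (M.map σ)ᵀ * (J : Matrix (Fin 3) (Fin 3) E) * M with hG
  have hGapply : ∀ k l : Fin 3, G k l = dotProduct (fun i => σ (col k i)) ((J : Matrix (Fin 3) (Fin 3) E) *ᵥ col l) := by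
    intro k l
    rw [hG, transpose_map_mul_mul_apply_eq_dotProduct σ J M k l]
    rfl
  -- the nine entries
  have hG00 : G 0 0 = σ c₀ * c₀ * d₀ := by
    rw [hGapply]
    change dotProduct (fun i => σ ((φ ((c₀, 0) : E × K) *ᵥ w₀) i)) ((J : Matrix (Fin 3) (Fin 3) E) *ᵥ (φ ((c₀, 0) : E × K) *ᵥ w₀)) = _
    rw [hcol0]
    have h : (fun i => σ ((c₀ • x₀) i)) = σ c₀ • fun i => σ (x₀ i) := by
      funext i; simp only [Pi.smul_apply, smul_eq_mul, map_mul]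
    rw [h, smul_dotProduct, Matrix.mulVec_smul, dotProduct_smul, smul_eq_mul, smul_eq_mul, mul_assoc]
  have hG01 : G 0 1 = 0 := by rw [hGapply]; exact pairing_fst_zero_snd_eq_zero σ σK J φ hstar c₀ b₂
  have hG02 : G 0 2 = 0 := by rw [hGapply]; exact pairing_fst_zero_snd_eq_zero σ σK J φ hstar c₀ _
  have hG10 : G 1 0 = 0 := by rw [hGapply]; exact pairing_zero_snd_fst_eq_zero σ σK J φ hstar c₀ b₂
  have hG20 : G 2 0 = 0 := by rw [hGapply]; exact pairing_zero_snd_fst_eq_zero σ σK J φ hstar c₀ _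
  have hG11 : G 1 1 = T00 := by rw [hGapply]; rfl
  have hG12 : G 1 2 = T01 := by rw [hGapply]; rfl
  have hG21 : G 2 1 = T10 := by rw [hGapply]; rfl
  have hG22 : G 2 2 = T11 := by rw [hGapply]; rfl
  -- determinant and integrality of the Gram
  have hGdet : G.det = σ c₀ * c₀ * d₀ * (T00 * T11 - T01 * T10) := by
    rw [Matrix.det_fin_three, hG00, hG01, hG02, hG10, hG11, hG12, hG20, hG21, hG22]; ring
  have hGdet1 : ValuativeRel.valuation E G.det = 1 := by rw [hGdet, map_mul, hd1, hdet, one_mul]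
  have hGdet0 : G.det ≠ 0 := fun h0 => by rw [h0, map_zero] at hGdet1; exact zero_ne_one hGdet1
  have hd0int : σ c₀ * c₀ * d₀ ∈ 𝒪[E] := (Valuation.mem_integer_iff _ _).2 hd1.le
  have hGint : IsIntegralMatrix G := by
    intro i j
    fin_cases i <;> fin_cases j
    · exact hG00 ▸ hd0int
    · exact hG01 ▸ Subring.zero_mem _
    · exact hG02 ▸ Subring.zero_mem _
    · exact hG10 ▸ Subring.zero_mem _
    · exact hG11 ▸ h00
    · exact hG12 ▸ h01
    · exact hG20 ▸ Subring.zero_mem _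
    · exact hG21 ▸ h10
    · exact hG22 ▸ h11
  -- `M` is invertible (its Gram is)
  have hMdet0 : M.det ≠ 0 := fun h0 => hGdet0 (by
    rw [hG, Matrix.det_mul, h0, mul_zero])
  set g : GL (Fin 3) E := Matrix.GeneralLinearGroup.mkOfDetNeZero M hMdet0 with hg
  have hgval : (g : Matrix (Fin 3) (Fin 3) E) = M := rfl
  set J' : GL (Fin 3) E := Matrix.GeneralLinearGroup.mkOfDetNeZero G hGdet0 with hJ'
  have hJ'val : (J' : Matrix (Fin 3) (Fin 3) E) = G := rfl
  have hJ'int : J' ∈ glInt 3 E := mem_glInt_of_isIntegralMatrix (by rw [hJ'val]; exact hGint) (by rw [hJ'val]; exact hGdet1)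
  have hform : (J' : Matrix (Fin 3) (Fin 3) E) = formCongr σ g (J : Matrix (Fin 3) (Fin 3) E) := by
    rw [hJ'val, hG]; rfl
  -- L1 docking: `Λ(g) = Λ(u)`
  obtain ⟨u, hu, huΛ⟩ := (exists_mem_unitary_span_eq_iff_selfDual σ J hσσ hσO htr hnorm hJ hJh
    (Submodule.span 𝒪[E] (Set.range ((g : Matrix (Fin 3) (Fin 3) E))ᵀ))).2 ⟨g, ⟨J', hJ'int, hform⟩, rfl⟩
  refine ⟨b₀, u, hu, ?_⟩
  rw [← huΛ]
  -- `Λ_{incl S}(φ(b₀) w₀) = Λ(g) = span {col j}`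
  have hO : ∀ r : 𝒪[E], algebraMap E (E × K) (r : E) ∈ O := by
    intro r
    refine Subring.mem_map.2 ⟨(r, jO r), ?_, ?_⟩
    · rw [← SetLike.mem_coe, hS]; exact ⟨r, 0, by simp⟩
    · ext
      · rfl
      · change ((jO r : 𝒪[K]) : K) = algebraMap E K (r : E); exact hjO r
  have hrange : Set.range ((g : Matrix (Fin 3) (Fin 3) E))ᵀ = Set.range col := by
    ext v
    simp only [Set.mem_range, hgval]
    constructor
    · rintro ⟨j, rfl⟩; exact ⟨j, by funext i; simp [hM, Matrix.transpose_apply]⟩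
    · rintro ⟨j, rfl⟩; exact ⟨j, by funext i; simp [hM, Matrix.transpose_apply]⟩
  rw [hrange]
  have hmem_m : ∀ j : Fin 3, m j ∈ O := by
    intro j
    fin_cases j
    · refine Subring.mem_map.2 ⟨((1, 0) : 𝒪[E] × 𝒪[K]), ?_, by ext <;> simp [hm]⟩
      rw [← SetLike.mem_coe, hS]; exact ⟨0, 0, by simp⟩
    · refine Subring.mem_map.2 ⟨((0, 1) : 𝒪[E] × 𝒪[K]), ?_, by ext <;> simp [hm]⟩
      rw [← SetLike.mem_coe, hS]; exact ⟨1, 0, by simp⟩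
    · refine Subring.mem_map.2 ⟨((0, PiN) : 𝒪[E] × 𝒪[K]), ?_, by ext <;> simp [hm]⟩
      rw [← SetLike.mem_coe, hS]; exact ⟨0, 1, by simp⟩
  apply le_antisymm
  · -- `⊆`: every `φ(x) φ(b₀) w₀`, `x ∈ incl S`, is an `𝒪`-combination of the `col j`
    rw [Submodule.span_le]
    rintro v ⟨x, hx, rfl⟩
    obtain ⟨z, hz, rfl⟩ := Subring.mem_map.1 hx
    have hz' : z ∈ (S : Set (𝒪[E] × 𝒪[K])) := hz
    rw [hS] at hz'
    obtain ⟨p, q, hzpq⟩ := hz'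
    -- `incl z = z.1 • m 0 + p • m 1 + q • m 2`
    have hdecomp : (RingHom.prodMap (𝒪[E]).subtype (𝒪[K]).subtype z : E × K) =
        (z.1 : E) • m 0 + (p : E) • m 1 + (q : E) • m 2 := by
      ext
      · simp [hm]
      · change ((z.2 : 𝒪[K]) : K) = _
        rw [hzpq]
        simp [hm, Algebra.smul_def, hjO, Subring.coe_add, Subring.coe_mul]
    change φ (RingHom.prodMap (𝒪[E]).subtype (𝒪[K]).subtype z) *ᵥ (φ (b₀ : E × K) *ᵥ w₀) ∈ _
    rw [← map_mul_mulVec, hdecomp, hb₀val]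
    simp only [add_mul, smul_mul_assoc, map_add, map_smul, Matrix.add_mulVec, Matrix.smul_mulVec, ← hcolm]
    have hmem : ∀ (r : 𝒪[E]) (j : Fin 3), (r : E) • col j ∈ Submodule.span 𝒪[E] (Set.range col) := fun r j =>
      Submodule.smul_mem _ r (Submodule.subset_span ⟨j, rfl⟩)
    exact Submodule.add_mem _ (Submodule.add_mem _ (hmem z.1 0) (hmem p 1)) (hmem q 2)
  · -- `⊇`: each `col j = φ(m j) φ(b₀) w₀` with `m j ∈ incl S`
    rw [Submodule.span_le]
    rintro v ⟨j, rfl⟩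
    refine Submodule.subset_span ⟨m j, hmem_m j, ?_⟩
    change φ (m j) *ᵥ (φ (b₀ : E × K) *ᵥ w₀) = col j
    rw [← map_mul_mulVec, hb₀val, hcolm]

end Witness

end Literature.NumberTheory.Automorphic

end
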